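import Literature.MathematicalPhysics.QuantumFieldTheory.Balaban1983to89.B9Eq327GreenZdHerm
import Literature.MathematicalPhysics.QuantumFieldTheory.Balaban1983to89.B9Thm311FlatHermKernelZd
import Literature.MathematicalPhysics.QuantumFieldTheory.Balaban1983to89.B9Eq326DeltaAHermitianZd

/-!
# `Balaban1983to89.B9Thm311FlatGreenZdHerm` — [Balaban1985BackgroundPropagators] (3.27) AT THE FLAT BACKGROUND, KERNEL-CHECKED: at every cube member of
# [Balaban1985RegularSpaces] (1.131) with print's class `cubeLamBP`, the GENUINE four-letter `Δ_a(1)` of the record `opsAllZd` restricted to `□₀` IS AN INVERTIBLE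
# OPERATOR OF THE HERMITIAN CARRIER `E_𝔤(□₀)` — `RegularAtH … 1` holds, the flat Green's function `G_𝔤(1) = (□₀Δ_a(1)□₀)⁻¹` exists, and the flat Dirichlet problem
# `□₀Δ_a(1)A = J` is uniquely solvable in `E_𝔤(□₀)`; on the way: `Δ_a(1)` is ℝ-LINEAR (`LinearOnDomAt`) at every member with finite `Ω₀` for EVERY averaging class —
# the `Q*aQ` letter WITHOUT the box clause

statement-level skeleton of published theorems with citation tags; proofs where landed; nothing here is a claim about the
Yang–Mills mass gap

`[Balaban1985BackgroundPropagators]` ("B9", CMP **99** (1985) 389–434) (3.27) p. 395 *«G(U) = G = (Δ_a↾Ω₀)⁻¹ … Ω₀ denotes also the characteristic function»*,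
Thm 3.11 p. 416 (proof, last lines: *«In [4] we have proved that the operator G_□(1) is positive»*), (3.26) p. 395, (3.16) p. 393, p. 391 *«hermitian matrices»*;
`[Balaban1984PropagatorsII]` ("[4]" = B6, CMP **96**) (2.11) p. 225; `[Balaban1985Averaging]` ("B7∕[5]") (122) p. 36; `[Balaban1985RegularSpaces]` ("B8") (1.131) p. 99,
(1.7) p. 77, (1.31) p. 82, (1.58) p. 86.

CITATION HEADER (lean-in-tree rule).  Cell `pub-ymgap` (YM Track A, HUMAN RULING D-0062 ∕ D-0149), node N06 = [B9]; seat `pub-ymgap-dag-n06-b` (g18), binder owner of the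
junction J-N06→N05.  This file CLOSES the flat base case of Theorem 3.11 at the object layer by joining this seat's `B9Eq327GreenZdHerm` (`domSubH`, `RegularAtH`,
`gopZdH`, `HermPreservingAt`, `regularAtH_of_bondPair_pos`) and `B9Thm311FlatHermKernelZd` (`flat_posDef_herm_cube`) with dag-n06-w2's `B9Eq326DeltaAHermitianZd`
(`isSelfAdjoint_deltaAOf_opsAllZd_one`: `Δ_a(1)` maps Hermitian fields of `E(Ω₀)` to Hermitian values — CLAIMED by n06-w2 first (bus CLAIM-9, 03:56Z) and imported
here BY NAME).  Of the two structural hypotheses of `regularAtH_of_bondPair_pos`, `HermPreservingAt` is therefore n06-w2's theorem read on `domSubH`; the other,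
`LinearOnDomAt` for the four-letter record at `U₀ = 1`, is PROVED here for every member with finite `Ω₀` and EVERY class: dag-n06-w4's `linearOnDomAt_opsGenuine`
needs the `Q*aQ` letter linear at the background, and the tree's `qqLinearAt_withQQP` carries the BOX CLAUSE «box of every class bond ⊂ Ω_{j−1}», which FAILS for
print's class `cubeLamBP` (a level-`0` crossing bond has an endpoint outside `□₀`); at the flat background the clause is not needed — the regime (1.7) holds at
`U₀ = 1` for the domain sequence `Ω ≡ ℤᵈ` (`reg17_one`), so `clsField_add_of_reg17 ∕ _smul_of_reg17` apply with the trivial box law (§1).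

WHAT IS PROVED (kernel, 0 sorry; theorems only; no `def`, no `instance`, no `notation`).
* §1 `QQZdP_one_eq` (the letter is the genuine sum at `U₀ = 1`, any class, any domains) · ★`QQZdP_one_add` · ★`QQZdP_one_smul_real` (NO box clause) ·
  `qqLinearAt_withQQP_one` · ★★`linearOnDomAt_opsAllZd_one`.
* §2 ★★`hermPreservingAt_opsAllZd_one` (n06-w2's theorem on `domSubH`) · ★★`regularAtH_opsAllZd_one_of_pos` (finite `Ω₀`, any class: flat positivity on
  `E_𝔤(Ω₀) ∖ 0` ⟹ `RegularAtH … 1`) · ★★★`regularAtH_opsAllZd_one_cube` (cube members, class `cubeLamBP`, `m ≤ k`: UNCONDITIONAL) · ★★★`gopZdH_one_deltaAOf_cube`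
  ((3.27) at `U = 1` as (1.58) uses it: `G_𝔤(1)(Δ_a(1)A) = A` on `E_𝔤(□₀)`) · ★★`existsUnique_flat_dirichlet_cube` (for every `J ∈ E_𝔤(□₀)` a unique `A ∈ E_𝔤(□₀)`
  with `□₀Δ_a(1)A = J`).

HONEST SCOPE.  (i) This is (3.27) ∕ Theorem 3.11's invertibility at ONE background, `U = 1`, on print's carrier and class, at the tree's cube members — the base
case «G_□(1)» of print's proof, now an OBJECT-LEVEL THEOREM (existence and uniqueness of the flat Green's function of the genuine four-letter operator); it is NOT
Theorem 3.11 (curved `U₀` in the class (3.35), uniform constants), gives NO estimate (3.115) on `G(1)`, and does not inhabit `PosDefInClassAtH ∕ RegularInClassAtH`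
(all `U₀` of the class) — steps (ii) continuity ∕ (iii) gauge covariance of IDEA-3.11 remain.  (ii) Count-neutral; N05 ∕ N06 NOT discharged; K1⁷
`stmt-QuantumFields-20542` NOT closed; 28∕28 · 5∕27 UNMOVED; one finite `𝕋⁴` programme at fixed `ε`, Bałaban as printed; nothing continuum ∕ ℝ⁴ ∕ OS ∕ mass gap ∕
Clay — R4 closes the conditional finite-`𝕋⁴` rung `BalabanLadder.UV` only.  Unit `pub-ymgap-dag-n06-b` (g18), 2026-08-28.
-/

noncomputable section

namespace Literature.MathematicalPhysics.QuantumFieldTheory.Balaban1983to89.B9Thm311FlatGreenZdHerm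

open B7Prop1Explicit
open B7Prop2Explicit (unitaryUnits)
open B8LeafModelZd (ZdIdx)
open B7Prop1Local (InBox loK bondHiK)
open B9Eq316AveragingTransposeZd (clsField linCovIterT wQ Reg17 alphaQ alphaQ_pos reg17_one)
open B9Eq316AveragingTransposeZdLinear (linCovIterT_add linCovIterT_smul clsField_add_of_reg17 clsField_smul_of_reg17)
open B9Eq316AveragingTransposeZdPrinted (QQZdP QQZdP_of_reg17 withQQP)
open B9Eq327GreenZd (domSub deltaADom LinearOnDomAt bondPair)
open B9Eq327GreenZdHerm (domSubH RegularAtH HermPreservingAt gopZdH regularAtH_of_bondPair_pos gopZdH_apply_eq_of_regularAtH)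
open B9SupplySockB9P3ZdLetters (OpsZd deltaAOf)
open B9SupplySockB9P3ZdGenuineGop (QQLinearAt linearOnDomAt_opsGenuine)
open B9SupplySockB9P3ZdAllLettersZd (opsAllZd)
open B9SupplySockB9P3ZdSkewGaugeMode (one_mem_unitaryUnits_cfg)
open B9Thm311FlatHermKernelZd (flat_posDef_herm_cube)
open B9Eq326DeltaAHermitianZd (isSelfAdjoint_deltaAOf_opsAllZd_one)
open B8Eq131Cubes (sqLo sqHi)
open B8Ineq159FlatCubeMemberPrinted (cubeLamBP)

export B7Prop1Explicit (Site)

variable {d : ℕ} {𝔸 : Type*} [CStarAlgebra 𝔸]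

/-! ## §1 `Δ_a(1)` of the four-letter record is ℝ-linear on all bond fields, for EVERY class (no box clause at the flat background) -/

section Linear

variable (τ : 𝔸 →ₗ[ℂ] ℂ) [Nontrivial 𝔸] [FiniteDimensional ℝ 𝔸] {L : ℕ}

omit [Nontrivial 𝔸] in
/-- **THE `Q*aQ` LETTER AT THE FLAT BACKGROUND IS THE GENUINE SUM** for every class and every domain sequence ((1.7) holds at `U₀ = 1`).
[cite: Balaban1985BackgroundPropagators, (3.16) p.393; Balaban1985RegularSpaces, (1.7) p.77] -/
theorem QQZdP_one_eq (hL : 1 ≤ L) (ΛbP : ℕ → ℕ → Set (Site d × Fin d)) (i : ZdIdx d L) (m : ℕ) (A : Site d → Fin d → 𝔸)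
    (y : Site d) (μ : Fin d) :
    QQZdP τ L ΛbP i m (1 : Site d → Fin d → 𝔸ˣ) A y μ =
      ∑ j ∈ Finset.range (m + 1), (wQ (d := d) L i.η j) • linCovIterT τ L (1 : Site d → Fin d → 𝔸ˣ) j (clsField L ΛbP i.η m j 1 A) y μ := by
  have hLr : (0 : ℝ) < (L : ℝ) ^ 2 := by positivity
  exact QQZdP_of_reg17 τ L (reg17_one hL (div_pos (alphaQ_pos d hL) hLr)) A y μ

/-- ★ **EDITION P's LETTER IS ADDITIVE AT THE FLAT BACKGROUND, ANY CLASS** (`L ≥ 2`): the box clause of `QQZdP_add` is not needed at `U₀ = 1`, where (1.7)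
holds for the domain sequence `Ω ≡ ℤᵈ`. [cite: Balaban1985BackgroundPropagators, (3.16) p.393; Balaban1985Averaging, (122) p.36; Balaban1985RegularSpaces, (1.7) p.77] -/
theorem QQZdP_one_add (hL : 2 ≤ L) (ΛbP : ℕ → ℕ → Set (Site d × Fin d)) (i : ZdIdx d L) (m : ℕ) (A A' : Site d → Fin d → 𝔸) :
    QQZdP τ L ΛbP i m (1 : Site d → Fin d → 𝔸ˣ) (A + A') = QQZdP τ L ΛbP i m 1 A + QQZdP τ L ΛbP i m 1 A' := by
  have hL1 : 1 ≤ L := le_trans (by norm_num) hL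
  have hreg' : Reg17 L m (fun _ => (Set.univ : Set (Site d))) (alphaQ d L) (1 : Site d → Fin d → 𝔸ˣ) := reg17_one hL1 (alphaQ_pos d hL1)
  funext y μ
  simp only [Pi.add_apply]
  rw [QQZdP_one_eq τ hL1, QQZdP_one_eq τ hL1, QQZdP_one_eq τ hL1, ← Finset.sum_add_distrib]
  refine Finset.sum_congr rfl fun j hjm => ?_
  have hj : j ≤ m := by rw [Finset.mem_range] at hjm; omega
  rw [clsField_add_of_reg17 hL (alphaQ_pos d hL1) le_rfl one_mem_unitaryUnits_cfg hreg' ΛbP hj (fun _ _ _ _ => Set.mem_univ _) i.η A A',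
    linCovIterT_add, smul_add]

/-- ★ **EDITION P's LETTER IS REAL-HOMOGENEOUS AT THE FLAT BACKGROUND, ANY CLASS.** [cite: Balaban1985BackgroundPropagators, (3.16) p.393; Balaban1985Averaging, (122) p.36; Balaban1985RegularSpaces, (1.7) p.77] -/
theorem QQZdP_one_smul_real (hL : 2 ≤ L) (ΛbP : ℕ → ℕ → Set (Site d × Fin d)) (i : ZdIdx d L) (m : ℕ) (r : ℝ) (A : Site d → Fin d → 𝔸) :
    QQZdP τ L ΛbP i m (1 : Site d → Fin d → 𝔸ˣ) (r • A) = r • QQZdP τ L ΛbP i m 1 A := by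
  have hL1 : 1 ≤ L := le_trans (by norm_num) hL
  have hreg' : Reg17 L m (fun _ => (Set.univ : Set (Site d))) (alphaQ d L) (1 : Site d → Fin d → 𝔸ˣ) := reg17_one hL1 (alphaQ_pos d hL1)
  funext y μ
  simp only [Pi.smul_apply]
  rw [QQZdP_one_eq τ hL1, QQZdP_one_eq τ hL1, Finset.smul_sum]
  refine Finset.sum_congr rfl fun j hjm => ?_
  have hj : j ≤ m := by rw [Finset.mem_range] at hjm; omega
  rw [clsField_smul_of_reg17 hL (alphaQ_pos d hL1) le_rfl one_mem_unitaryUnits_cfg hreg' ΛbP hj (fun _ _ _ _ => Set.mem_univ _) i.η r A,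
    linCovIterT_smul, smul_comm]

/-- ★ **`QQLinearAt` FOR EDITION P AT THE FLAT BACKGROUND, ANY CLASS.** [cite: Balaban1985BackgroundPropagators, (3.16) p.393 («an operator Q*aQ»)] -/
theorem qqLinearAt_withQQP_one (hL : 2 ≤ L) (ΛbP : ℕ → ℕ → Set (Site d × Fin d)) (ops₀ : ℝ → ZdIdx d L → ℕ → OpsZd d 𝔸) (M : ℝ)
    (i : ZdIdx d L) (m : ℕ) : QQLinearAt (withQQP τ L ΛbP ops₀ M i m) 1 :=
  ⟨{ toFun := QQZdP τ L ΛbP i m 1, map_add' := QQZdP_one_add τ hL ΛbP i m, map_smul' := QQZdP_one_smul_real τ hL ΛbP i m },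
    fun _ => rfl⟩

/-- ★★ **`Δ_a(1)` OF THE FOUR-LETTER RECORD IS THE RESTRICTION OF AN ℝ-LINEAR MAP** at every member with finite `Ω₀`, for EVERY class (`L ≥ 2`).
[cite: Balaban1985BackgroundPropagators, (3.26) p.395 (Δ_a is a linear operator)] -/
theorem linearOnDomAt_opsAllZd_one (hL : 2 ≤ L) (ΛbP : ℕ → ℕ → Set (Site d × Fin d)) (ops₀ : ℝ → ZdIdx d L → ℕ → OpsZd d 𝔸) (M : ℝ)
    (i : ZdIdx d L) (m : ℕ) (hΩ : (i.Ω 0).Finite) : LinearOnDomAt i.η (opsAllZd τ L ΛbP ops₀ M i m) (i.Ω 0) 1 :=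
  linearOnDomAt_opsGenuine τ (withQQP τ L ΛbP ops₀) M i m hΩ 1 (qqLinearAt_withQQP_one τ hL ΛbP ops₀ M i m)

end Linear

/-! ## §2 ASSEMBLY: `HermPreservingAt` (dag-n06-w2's Hermiticity BY NAME), `RegularAtH` at the flat background; the flat Green's function at every cube member -/

section Assembly

variable (τ : 𝔸 →ₗ[ℂ] ℂ) [Nontrivial 𝔸] [FiniteDimensional ℝ 𝔸] {L : ℕ}

/-- ★★ **`HermPreservingAt` FOR THE FOUR-LETTER RECORD AT `U₀ = 1`** (finite `Ω₀`, `L ≥ 2`, any class, faithful Hermitian tracial `τ`) — dag-n06-w2's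
`B9Eq326DeltaAHermitianZd.isSelfAdjoint_deltaAOf_opsAllZd_one` BY NAME, read on `E_𝔤(Ω₀) = domSubH`. [cite: Balaban1985BackgroundPropagators, (3.26) p.395, p.391 («hermitian matrices»)] -/
theorem hermPreservingAt_opsAllZd_one (hτt : ∀ a b : 𝔸, τ (a * b) = τ (b * a)) (hτs : ∀ a : 𝔸, τ (star a) = starRingEnd ℂ (τ a))
    (hτp : ∀ a : 𝔸, a ≠ 0 → 0 < (τ (star a * a)).re) (hL : 2 ≤ L) (ΛbP : ℕ → ℕ → Set (Site d × Fin d))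
    (ops₀ : ℝ → ZdIdx d L → ℕ → OpsZd d 𝔸) (M : ℝ) (i : ZdIdx d L) (m : ℕ) (hΩ : (i.Ω 0).Finite) :
    HermPreservingAt i.η (opsAllZd τ L ΛbP ops₀ M i m) (i.Ω 0) 1 :=
  fun _ hA y μ _ => isSelfAdjoint_deltaAOf_opsAllZd_one τ (le_trans (by norm_num) hL) hτp hτt hτs ΛbP ops₀ M i m hΩ hA.1 hA.2 y μ

/-- ★★ **FLAT POSITIVITY ON `E_𝔤(Ω₀) ∖ 0` GIVES `RegularAtH` AT `U₀ = 1`** (finite `Ω₀`, `L ≥ 2`, any class): the two structural hypotheses of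
`regularAtH_of_bondPair_pos` are theorems (§1; dag-n06-w2's `isSelfAdjoint_deltaAOf_opsAllZd_one`). [cite: Balaban1985BackgroundPropagators, Thm 3.11 p.416, (3.27) p.395] -/
theorem regularAtH_opsAllZd_one_of_pos (hτt : ∀ a b : 𝔸, τ (a * b) = τ (b * a)) (hτs : ∀ a : 𝔸, τ (star a) = starRingEnd ℂ (τ a))
    (hτp : ∀ a : 𝔸, a ≠ 0 → 0 < (τ (star a * a)).re) (hL : 2 ≤ L) (ΛbP : ℕ → ℕ → Set (Site d × Fin d))
    (ops₀ : ℝ → ZdIdx d L → ℕ → OpsZd d 𝔸) (M : ℝ) (i : ZdIdx d L) (m : ℕ) (hΩ : (i.Ω 0).Finite)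
    (hpos : ∀ A ∈ domSubH (𝔸 := 𝔸) (i.Ω 0), A ≠ 0 → 0 < bondPair τ A (deltaAOf i.η (opsAllZd τ L ΛbP ops₀ M i m) 1 A)) :
    RegularAtH i.η (opsAllZd τ L ΛbP ops₀ M i m) (i.Ω 0) 1 :=
  regularAtH_of_bondPair_pos τ hΩ (linearOnDomAt_opsAllZd_one τ hL ΛbP ops₀ M i m hΩ)
    (hermPreservingAt_opsAllZd_one τ hτt hτs hτp hL ΛbP ops₀ M i m hΩ) hpos

/-- ★★★ **[B9] (3.27) AT THE FLAT BACKGROUND, EVERY CUBE MEMBER — `G_𝔤(1) = (□₀Δ_a(1)□₀)⁻¹` EXISTS**: at a cube member `{□_j}` of (1.131) (`Ω = cubeFam false …`,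
`Λs = cubeLamS …`, `d ≥ 2`, `L ≥ 2`), every `m ≤ k`, print's class `cubeLamBP`, a faithful Hermitian tracial `τ` on a finite-dimensional fibre: the genuine four-letter
`Δ_a(1)↾□₀` agrees on `E_𝔤(□₀)` with an INVERTIBLE operator of `E_𝔤(□₀)` — UNCONDITIONAL (positivity = `flat_posDef_herm_cube`). [cite: Balaban1985BackgroundPropagators, (3.27) p.395, Thm 3.11 p.416 («G_□(1)»); Balaban1984PropagatorsII, (2.11) p.225; Balaban1985RegularSpaces, (1.131) p.99] -/
theorem regularAtH_opsAllZd_one_cube (hτt : ∀ a b : 𝔸, τ (a * b) = τ (b * a)) (hτs : ∀ a : 𝔸, τ (star a) = starRingEnd ℂ (τ a))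
    (hτp : ∀ a : 𝔸, a ≠ 0 → 0 < (τ (star a * a)).re) (hd2 : 2 ≤ d) (hL : 2 ≤ L) (ops₀ : ℝ → ZdIdx d L → ℕ → OpsZd d 𝔸) (M : ℝ) (i : ZdIdx d L)
    {a : Site d} {Mc ρ : ℕ} (hΩ : i.Ω = B8Eq131CubesAdmissible.cubeFam false L a Mc ρ i.k) (hΛs : i.Λs = B8CubeMemberZd.cubeLamS L a Mc ρ i.k)
    {m : ℕ} (hm : m ≤ i.k) :
    RegularAtH i.η (opsAllZd τ L (cubeLamBP L a Mc ρ i.k) ops₀ M i m) (i.Ω 0) 1 := by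
  have hfin : (i.Ω 0).Finite := by
    rw [hΩ, B8Eq131CubesAdmissible.cubeFam_false_zero]
    exact B8Eq191FlatLettersCubeMember.inBox_finite (sqLo L a ρ i.k 0) (sqHi L a Mc ρ i.k 0)
  exact regularAtH_opsAllZd_one_of_pos τ hτt hτs hτp hL _ ops₀ M i m hfin
    fun A hA hA0 => flat_posDef_herm_cube τ hτt hτs hτp hd2 hL ops₀ M i hΩ hΛs hm hA.1 hA.2 hA0

/-- ★★★ **(3.27) AT `U = 1` AS (1.58) USES IT: `G_𝔤(1)(Δ_a(1)A) = A`** for every Hermitian `A ∈ E(□₀)` at a cube member (class `cubeLamBP`, `m ≤ k`) — the flat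
Green's function of this seat's `gopZdH` inverts the genuine four-letter operator on print's carrier. [cite: Balaban1985BackgroundPropagators, (3.27) p.395; Balaban1985RegularSpaces, (1.58) p.86] -/
theorem gopZdH_one_deltaAOf_cube (hτt : ∀ a b : 𝔸, τ (a * b) = τ (b * a)) (hτs : ∀ a : 𝔸, τ (star a) = starRingEnd ℂ (τ a))
    (hτp : ∀ a : 𝔸, a ≠ 0 → 0 < (τ (star a * a)).re) (hd2 : 2 ≤ d) (hL : 2 ≤ L) (ops₀ : ℝ → ZdIdx d L → ℕ → OpsZd d 𝔸) (M : ℝ) (i : ZdIdx d L)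
    {a : Site d} {Mc ρ : ℕ} (hΩ : i.Ω = B8Eq131CubesAdmissible.cubeFam false L a Mc ρ i.k) (hΛs : i.Λs = B8CubeMemberZd.cubeLamS L a Mc ρ i.k)
    {m : ℕ} (hm : m ≤ i.k) {A : Site d → Fin d → 𝔸} (hA : A ∈ domSubH (𝔸 := 𝔸) (i.Ω 0)) :
    gopZdH i.η (opsAllZd τ L (cubeLamBP L a Mc ρ i.k) ops₀ M i m) (i.Ω 0) 1
        (deltaAOf i.η (opsAllZd τ L (cubeLamBP L a Mc ρ i.k) ops₀ M i m) 1 A) = A :=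
  gopZdH_apply_eq_of_regularAtH i.η _ (i.Ω 0) 1 (regularAtH_opsAllZd_one_cube τ hτt hτs hτp hd2 hL ops₀ M i hΩ hΛs hm) hA
    fun _ _ _ => rfl

/-- ★★ **THE FLAT DIRICHLET PROBLEM IS UNIQUELY SOLVABLE ON `E_𝔤(□₀)`**: at a cube member (class `cubeLamBP`, `m ≤ k`), for every `J ∈ E_𝔤(□₀)` there is exactly one
`A ∈ E_𝔤(□₀)` with `□₀Δ_a(1)A = J` (`deltaADom … 1 A = J`). [cite: Balaban1985BackgroundPropagators, (3.27) p.395 («G = (Δ_a↾Ω₀)⁻¹»); Balaban1984PropagatorsII, (2.11) p.225] -/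
theorem existsUnique_flat_dirichlet_cube (hτt : ∀ a b : 𝔸, τ (a * b) = τ (b * a)) (hτs : ∀ a : 𝔸, τ (star a) = starRingEnd ℂ (τ a))
    (hτp : ∀ a : 𝔸, a ≠ 0 → 0 < (τ (star a * a)).re) (hd2 : 2 ≤ d) (hL : 2 ≤ L) (ops₀ : ℝ → ZdIdx d L → ℕ → OpsZd d 𝔸) (M : ℝ) (i : ZdIdx d L)
    {a : Site d} {Mc ρ : ℕ} (hΩ : i.Ω = B8Eq131CubesAdmissible.cubeFam false L a Mc ρ i.k) (hΛs : i.Λs = B8CubeMemberZd.cubeLamS L a Mc ρ i.k)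
    {m : ℕ} (hm : m ≤ i.k) {J : Site d → Fin d → 𝔸} (hJ : J ∈ domSubH (𝔸 := 𝔸) (i.Ω 0)) :
    ∃! A : domSubH (𝔸 := 𝔸) (i.Ω 0), deltaADom i.η (opsAllZd τ L (cubeLamBP L a Mc ρ i.k) ops₀ M i m) (i.Ω 0) 1 A = J := by
  obtain ⟨Φ, hΦ, hbij⟩ := regularAtH_opsAllZd_one_cube τ hτt hτs hτp hd2 hL ops₀ M i hΩ hΛs hm
  obtain ⟨A, hA⟩ := hbij.2 ⟨J, hJ⟩
  refine ⟨A, ?_, fun B hB => ?_⟩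
  · show deltaADom i.η _ (i.Ω 0) 1 A = J
    rw [← hΦ A, hA]
  · apply hbij.1
    apply Subtype.ext
    rw [hΦ B, hB, hA]

end Assembly

end Literature.MathematicalPhysics.QuantumFieldTheory.Balaban1983to89.B9Thm311FlatGreenZdHerm

end
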